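import Summits.CriticalPhenomena.PercolationContinuityZ3.Theorems.PercNearOneGluingNoHeavyQuantAdditiveGluingTransferDefect
import Summits.CriticalPhenomena.PercolationContinuityZ3.Theorems.PercNearOneGluingNoHeavyQuantEffectiveTargetLemma
import HarnessLib

/-!
# QUANT lane, tolerance pass-through («TOL»): Kozma–Nitzan's Lemma 10 (additive, effective) under an η-DEFECTIVE additive
# gluing inequality — loss `6δ + η`, threshold form `TargetPropertyAt d p (7δ + η) δ H R`

builds on p205010 (kernel theorem, internal audit signed; external expert review pending)

Lane `prim-rate` (effectivity audit, seat audit-3), deliverable (b) (HOME/SUBSTITUTES.md §TOL).  Support file (helper) for the closed crux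
`AdditiveGluing` (stmt-CriticalPhenomena-4576); continuation of `…QuantAdditiveGluingTransferDefect.lean`.  No definitions, no
sorries, standard axioms.
* `targetLemma_additive_core_defect` / `targetLemma_additive_defect` — the tree's `Quant.targetLemma_additive_core` /
  `Quant.targetLemma_additive` (…QuantEffectiveTargetLemma.lean) verbatim with an η-defective transported gluing hypothesis
  (`hGlue`, region `↑D`) in place of the tree's call of `Quant.additiveGluing_finSupp_set`, and Step V replaced by
  `Defect.stepV_additive_defect`: conclusion `μ(o ↔ B) − 6δ − η ≤ μ(o ↔ T)`;
* `targetLemma_effective_defect` — threshold form under a GLOBAL η-defective transported gluing hypothesis: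
  `TargetPropertyAt d p (7δ + η) δ H R`;
* `targetPropertyAt_of_additiveGluingDefect` — COMPOSITION from an η-defective additive gluing inequality over `Fin n` (the level
  at which a substitute for the finite-graph engine would deliver it) through `Defect.additiveGluing_finSupp_set_defect`:
  `0 ≤ η → hAG → (a)–(e) → TargetPropertyAt d p (7δ + η) δ H R`.  At `η = 0` this is `Quant.targetLemma_effective`.
`hη : 0 ≤ η` is used only in the trivial branch `B = ∅`; the scale hypotheses (a)–(e) and the margin `R` are untouched.
[cite: KozmaNitzan2024, §4 Lemma 10 (pp. 17–22)]
-/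

noncomputable section

namespace Summit.CriticalPhenomena.PercolationContinuityZ3.Theorems.Quant

namespace Defect

open MeasureTheory Literature.Probability.LatticeModels Literature.Probability.Percolation
  Literature.Probability.Percolation.KozmaNitzan

variable {d : ℕ}

/-- **Lemma 10 core (bounded route-scale range `[ℓmax, ℓhi]`) under an η-defective transported gluing hypothesis**: the
hypotheses (a)–(e) of `Quant.targetLemma_additive_core`, `η ≥ 0` and `hGlue` give `μ(o ↔ B) − 6δ − η ≤ μ(o ↔ T)`.
builds on p205010 (kernel theorem, internal audit signed; external expert review pending).
[cite: KozmaNitzan2024, §4 Lemma 10 (pp. 17–22)] -/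
theorem targetLemma_additive_core_defect [NeZero d] (p : unitInterval) (hp1 : (p : ℝ) < 1)
    {δ : ℝ} (hδ : 0 < δ) (H : List (Geom d)) {m M ℓmax ℓhi k R : ℕ} (hmM : m < M)
    (hhit : ∀ g ∈ H, ∀ ℓ : ℕ, ℓmax ≤ ℓ → ℓ ≤ ℓhi →
      1 - δ ^ 2 < (bondPercolation (zdGraph d) p).real (linkIn (↑(g.Qset ℓ 0)) (box d m) (g.Fset ℓ 0)))
    (hface : ∀ (a : Fin d) (τ : Fin d → ℤˣ),
      1 - δ ^ 2 < (bondPercolation (zdGraph d) p).real (linkEvent (box d m) (orthantFace a τ M) M))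
    (huniq : 1 - δ ^ 2 < (bondPercolation (zdGraph d) p).real (uniqZone m M))
    (hk : (1 - (p : ℝ) ^ seedBound d M) ^ k ≤ δ)
    (hR : 3 * M + ℓmax + 4 + ⌈(1 / (1 - (p : ℝ)) ^ (2 * d * LData.Ncont d M k)) / δ⌉₊ ≤ R)
    (W : Sym2 (Site d) → unitInterval) (Sfin D : Finset (Site d)) (lo hi : Site d)
    (T : Finset (Site d)) (o : Site d)
    (hfin : FinSupp W Sfin) (hsub : IsSubbox W p D) (hDS : D ⊆ Sfin) (ho : o ∈ Sfin) (hoD : o ∉ D)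
    (hBR : Finset.Icc (lo - (R : Site d)) (hi + (R : Site d)) ⊆ D)
    (htgt : ∀ v ∈ Finset.Icc (lo - (R : Site d)) (hi + (R : Site d)), ∃ ℓ : ℕ, R ≤ ℓ ∧ ℓ ≤ ℓhi ∧
      ∃ g ∈ H, g.Qset ℓ v ⊆ D ∧ g.Fset ℓ v ⊆ T)
    {η : ℝ} (hη : 0 ≤ η)
    (hGlue : ∀ (w' : Sym2 (Site d) → unitInterval), (∀ e : Sym2 (Site d), (∃ x ∈ e, x ∉ Sfin) → w' e = 0) →
      ∀ (A : Finset (Site d)), A ⊆ Sfin → ∀ {t : ℝ}, 0 ≤ t →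
      (∀ a ∈ A, 1 - t ≤ (prodBernoulli w').real (⋃ x ∈ T, openConnIn (↑D : Set (Site d)) a x)) →
      (prodBernoulli w').real (⋃ a ∈ A, openConn o a) - t - η ≤ (prodBernoulli w').real (⋃ x ∈ T, openConn o x)) :
    (prodBernoulli W).real (⋃ b ∈ Finset.Icc lo hi, openConn o b) - 6 * δ - η ≤
      (prodBernoulli W).real (⋃ t ∈ T, openConn o t) := by
  classical
  set μ := prodBernoulli W with hμ
  -- `lo ≤ hi`, else `B = ∅` and the claim is trivial
  by_cases hlohi : lo ≤ hi
  swap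
  · have : Finset.Icc lo hi = ∅ := Finset.Icc_eq_empty hlohi
    rw [this]
    simp only [Finset.notMem_empty, Set.iUnion_of_empty, Set.iUnion_empty, measureReal_empty]
    linarith [(measureReal_nonneg : 0 ≤ μ.real (⋃ t ∈ T, openConn o t))]
  -- the number of contacts `N`, of levels
  set N := LData.Ncont d M k with hN
  set K₀ : ℝ := 1 / (1 - (p : ℝ)) ^ (2 * d * N) with hK₀
  set Lcount : ℕ := ⌈K₀ / δ⌉₊ + 1 with hLcount
  set j₀ : ℕ := 2 * M + 2 with hj₀
  set j₁ : ℕ := j₀ + Lcount - 1 with hj₁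
  -- the level data and hypotheses
  set L : LData d := ⟨lo, hi, o, Sfin⟩ with hLdef
  have hL : LHyp L W p D (R - 1) :=
    { sub := hsub
      fin := hfin
      DS := hDS
      encl := by
        have : R - 1 + 1 = R := by omega
        rw [this]; exact hBR
      o_not := hoD
      o_mem := ho }
  -- Step II (defect form)
  have hj₁R : j₁ ≤ R - 1 := by omega
  have hcard : ((Finset.Icc j₀ j₁).card : ℝ) = Lcount := by
    rw [Nat.card_Icc]; congr 1; omega
  have hJ : 1 / (1 - (p : ℝ)) ^ (2 * d * N) ≤ δ * ((Finset.Icc j₀ j₁).card : ℝ) := by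
    rw [hcard, hLcount]
    push_cast
    have h1 : K₀ / δ ≤ ⌈K₀ / δ⌉₊ := Nat.le_ceil _
    have h2 : K₀ = δ * (K₀ / δ) := by field_simp
    rw [← hK₀]
    nlinarith
  obtain ⟨j, hjJ, hII⟩ := stepII_defect hL hp1 (N := N) hj₁R hJ
  obtain ⟨hj₀j, hjj₁⟩ := Finset.mem_Icc.1 hjJ
  have hjR : j ≤ R - 1 := hjj₁.trans hj₁R
  have hjM : 2 * M + 2 ≤ j := hj₀j
  have hwide : ∀ k', L.Lo j k' + 2 * M + 2 ≤ L.Hi j k' := by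
    intro k'
    simp only [LData.Lo, LData.Hi, Pi.sub_apply, Pi.add_apply, Pi.natCast_apply]
    have : L.lo k' ≤ L.hi k' := hlohi k'
    omega
  -- the shell
  set S := L.X (j - 1) \ L.X (j - (2 * M + 2)) with hSdef
  have hS : S ⊆ Finset.Icc (L.Lo j + 1) (L.Hi j - 1) := LData.shell_subset_shrink (by omega)
  have hSD : S ⊆ D := (Finset.sdiff_subset).trans (hL.X_subset_D (by omega))
  have hmM' : m ≤ M := hmM.le
  -- the faces lie in the shell
  have hUS : ∀ x ∈ outerBoundary (zdGraph d) (L.X j), L.ufaceX j M x ⊆ S := by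
    intro x hx
    obtain ⟨h, -⟩ := LData.winData_spec hwide hx
    refine (uface_subset_cube h).trans ?_
    change L.cubeX j M x ⊆ S
    rw [LData.cubeX_eq_ball]
    exact LData.ball_vX_subset_shell hjM hwide hx
  -- Step IV at every contact vertex: a relay reliable to `T` inside `D`
  have hIV : ∀ x ∈ outerBoundary (zdGraph d) (L.X j),
      1 - 3 * δ ≤ μ.real {ω | ∃ u ∈ L.ufaceX j M x,
        1 - δ < (prodBernoulli (pinW W (wireSet (↑S : Set (Site d))) ω)).real
          (⋃ t ∈ T, openConnIn (↑D : Set (Site d)) u t)} := by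
    intro x hx
    set v := L.vX j M x with hv
    have hballS : GM.ball v M ⊆ S := LData.ball_vX_subset_shell hjM hwide hx
    have hballD : (↑(GM.ball v M) : Set (Site d)) ⊆ ↑D := Finset.coe_subset.2 (hballS.trans hSD)
    -- the target route from `v`
    have hvB : v ∈ Finset.Icc (lo - (R : Site d)) (hi + (R : Site d)) := by
      have := LData.vX_mem (L := L) (by omega) hwide hx
      exact Icc_enlarge_mono (show j - 1 ≤ R by omega) this
    obtain ⟨ℓ, hRℓ, hℓhi, g, hg, hQ, hF⟩ := htgt v hvB
    have hMℓ : M < ℓ := lt_of_lt_of_le (by omega) hRℓ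
    -- (1) uniqueness zone
    have h1 : 1 - δ ^ 2 < μ.real (uniqZoneAt v m M) := by
      rw [hμ, hsub.real_eq_bondPercolation (determinedBy_uniqZoneAt v m M (wireSet_mono hballD))
        (measurableSet_uniqZoneAt v m M), real_uniqZoneAt_eq]
      exact huniq
    -- (2) the face
    have h2 : 1 - δ ^ 2 < μ.real (linkIn (↑(GM.ball v M)) (GM.ball v m) (L.ufaceX j M x)) := by
      obtain ⟨a, τ, hsubU⟩ := LData.orthantFace_image_subset_ufaceX hwide hx
      have hmono : linkIn (↑(GM.ball v M)) (GM.ball v m) ((orthantFace a τ M).image (· + v)) ⊆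
          linkIn (↑(GM.ball v M)) (GM.ball v m) (L.ufaceX j M x) := linkIn_mono le_rfl le_rfl hsubU
      refine lt_of_lt_of_le ?_ (measureReal_mono hmono)
      rw [hμ, hsub.real_eq_bondPercolation (determinedBy_linkIn _ _ _ (wireSet_mono hballD))]
      · have e1 : GM.ball v M = (box d M).image (· + v) := rfl
        have e2 : GM.ball v m = (box d m).image (· + v) := rfl
        rw [e1, e2, real_linkIn_image_add]
        exact hface a τ
      · exact measurableSet_linkIn _ _ _
    -- (3) the target route
    have h3 : 1 - δ ^ 2 < μ.real (linkIn (↑(g.Qset ℓ v)) (GM.ball v m) (g.Fset ℓ v)) := by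
      rw [hμ, hsub.real_eq_bondPercolation (determinedBy_linkIn _ _ _ (wireSet_mono (Finset.coe_subset.2 hQ)))
        (measurableSet_linkIn _ _ _)]
      have e2 : GM.ball v m = (box d m).image (· + v) := rfl
      rw [g.Qset_eq_image ℓ v, g.Fset_eq_image ℓ v, e2, real_linkIn_image_add]
      exact hhit g hg ℓ (le_trans (by omega) hRℓ) hℓhi
    exact stepIV_in (S := S) hsub hF hQ hmM' hballS (LData.ufaceX_subset_innerBoundary hwide hx)
      (g.disjoint_Fset_ball hMℓ v) hδ (Rg := (↑D : Set (Site d))) hballD (Finset.coe_subset.2 hQ) h1 h2 h3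
  -- Step V (additive)
  have hV := stepV_additive_defect hL (Rg := (↑D : Set (Site d))) hjR hwide hS hSD hδ (η := η) hGlue hII hk hUS hIV
  exact hV

/-- **Lemma 10 for targets in the tree's sense (`IsTarget`, unbounded route scales) under an η-defective transported gluing
hypothesis**: loss `6δ + η`.
builds on p205010 (kernel theorem, internal audit signed; external expert review pending).
[cite: KozmaNitzan2024, §4 Lemma 10 (pp. 17–22)] -/
theorem targetLemma_additive_defect [NeZero d] (p : unitInterval) (hp1 : (p : ℝ) < 1)
    {δ : ℝ} (hδ : 0 < δ) (H : List (Geom d)) {m M ℓmax k R : ℕ} (hmM : m < M)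
    (hhit : ∀ g ∈ H, ∀ ℓ : ℕ, ℓmax ≤ ℓ →
      1 - δ ^ 2 < (bondPercolation (zdGraph d) p).real (linkIn (↑(g.Qset ℓ 0)) (box d m) (g.Fset ℓ 0)))
    (hface : ∀ (a : Fin d) (τ : Fin d → ℤˣ),
      1 - δ ^ 2 < (bondPercolation (zdGraph d) p).real (linkEvent (box d m) (orthantFace a τ M) M))
    (huniq : 1 - δ ^ 2 < (bondPercolation (zdGraph d) p).real (uniqZone m M))
    (hk : (1 - (p : ℝ) ^ seedBound d M) ^ k ≤ δ)
    (hR : 3 * M + ℓmax + 4 + ⌈(1 / (1 - (p : ℝ)) ^ (2 * d * LData.Ncont d M k)) / δ⌉₊ ≤ R)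
    (W : Sym2 (Site d) → unitInterval) (Sfin D : Finset (Site d)) (lo hi : Site d)
    (T : Finset (Site d)) (o : Site d)
    (hfin : FinSupp W Sfin) (hsub : IsSubbox W p D) (hDS : D ⊆ Sfin) (ho : o ∈ Sfin) (hoD : o ∉ D)
    (hBR : Finset.Icc (lo - (R : Site d)) (hi + (R : Site d)) ⊆ D)
    (htgt : IsTarget T lo hi D R H)
    {η : ℝ} (hη : 0 ≤ η)
    (hGlue : ∀ (w' : Sym2 (Site d) → unitInterval), (∀ e : Sym2 (Site d), (∃ x ∈ e, x ∉ Sfin) → w' e = 0) →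
      ∀ (A : Finset (Site d)), A ⊆ Sfin → ∀ {t : ℝ}, 0 ≤ t →
      (∀ a ∈ A, 1 - t ≤ (prodBernoulli w').real (⋃ x ∈ T, openConnIn (↑D : Set (Site d)) a x)) →
      (prodBernoulli w').real (⋃ a ∈ A, openConn o a) - t - η ≤ (prodBernoulli w').real (⋃ x ∈ T, openConn o x)) :
    (prodBernoulli W).real (⋃ b ∈ Finset.Icc lo hi, openConn o b) - 6 * δ - η ≤
      (prodBernoulli W).real (⋃ t ∈ T, openConn o t) := by
  classical
  -- choose a route for every `v ∈ B⟨R⟩` and bound the finitely many chosen scales by their maximum `ℓhi`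
  have hch : ∀ v ∈ Finset.Icc (lo - (R : Site d)) (hi + (R : Site d)), ∃ ℓ : ℕ, R ≤ ℓ ∧
      ∃ g ∈ H, g.Qset ℓ v ⊆ D ∧ g.Fset ℓ v ⊆ T := htgt.hit
  choose! ℓof hℓof using hch
  set ℓhi := (Finset.Icc (lo - (R : Site d)) (hi + (R : Site d))).sup ℓof with hℓhi
  refine targetLemma_additive_core_defect p hp1 hδ H (ℓhi := ℓhi) hmM (fun g hg ℓ hℓ _ => hhit g hg ℓ hℓ) hface huniq hk
    hR W Sfin D lo hi T o hfin hsub hDS ho hoD hBR (fun v hv => ?_) hη hGlue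
  obtain ⟨hRℓ, g, hg, hQ, hF⟩ := hℓof v hv
  exact ⟨ℓof v, hRℓ, Finset.le_sup (f := ℓof) hv, g, hg, hQ, hF⟩

/-- **Lemma 10 EFFECTIVE, threshold form, under a GLOBAL η-defective transported gluing hypothesis** (every support set,
region, target set and observer): `TargetPropertyAt d p (7δ + η) δ H R`.  At `η = 0`: `Quant.targetLemma_effective`.
builds on p205010 (kernel theorem, internal audit signed; external expert review pending).
[cite: KozmaNitzan2024, §4 Lemma 10 (pp. 17–22)] -/
theorem targetLemma_effective_defect [NeZero d] (p : unitInterval) (hp1 : (p : ℝ) < 1)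
    {δ : ℝ} (hδ : 0 < δ) (H : List (Geom d)) {m M ℓmax k R : ℕ} (hmM : m < M)
    (hhit : ∀ g ∈ H, ∀ ℓ : ℕ, ℓmax ≤ ℓ →
      1 - δ ^ 2 < (bondPercolation (zdGraph d) p).real (linkIn (↑(g.Qset ℓ 0)) (box d m) (g.Fset ℓ 0)))
    (hface : ∀ (a : Fin d) (τ : Fin d → ℤˣ),
      1 - δ ^ 2 < (bondPercolation (zdGraph d) p).real (linkEvent (box d m) (orthantFace a τ M) M))
    (huniq : 1 - δ ^ 2 < (bondPercolation (zdGraph d) p).real (uniqZone m M))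
    (hk : (1 - (p : ℝ) ^ seedBound d M) ^ k ≤ δ)
    (hR : 3 * M + ℓmax + 4 + ⌈(1 / (1 - (p : ℝ)) ^ (2 * d * LData.Ncont d M k)) / δ⌉₊ ≤ R)
    {η : ℝ} (hη : 0 ≤ η)
    (hGlueAll : ∀ (Sf : Finset (Site d)) (Rg : Set (Site d)) (T : Finset (Site d)) (o : Site d)
      (w' : Sym2 (Site d) → unitInterval), (∀ e : Sym2 (Site d), (∃ x ∈ e, x ∉ Sf) → w' e = 0) →
      ∀ (A : Finset (Site d)), A ⊆ Sf → ∀ {t : ℝ}, 0 ≤ t →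
      (∀ a ∈ A, 1 - t ≤ (prodBernoulli w').real (⋃ x ∈ T, openConnIn Rg a x)) →
      (prodBernoulli w').real (⋃ a ∈ A, openConn o a) - t - η ≤ (prodBernoulli w').real (⋃ x ∈ T, openConn o x)) :
    TargetPropertyAt d p (7 * δ + η) δ H R := by
  intro W Sfin D lo hi T o hfin hsub hDS ho hoD hBR htgt _ _ hreach
  have h := targetLemma_additive_defect p hp1 hδ H hmM hhit hface huniq hk hR W Sfin D lo hi T o hfin hsub hDS ho hoD hBR
    htgt hη (hGlueAll Sfin (↑D : Set (Site d)) T o)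
  linarith

/-- **THE TOLERANCE CHAIN, COMPOSED**: an η-defective additive gluing inequality over `Fin n` (`η ≥ 0`; `η = 0` is the tree
theorem `AdditiveGluing_proof`) and the scale-indexed hypotheses (a)–(e) give `TargetPropertyAt d p (7δ + η) δ H R` — the
defect is paid ONCE, with constant `1`, through the transports (`Defect.additiveGluing_finSupp_set_defect`), Step V and Lemma 10.
builds on p205010 (kernel theorem, internal audit signed; external expert review pending).
[cite: KozmaNitzan2024, §4 Lemma 10 (pp. 17–22); Conjecture 1 (p. 3)] -/
theorem targetPropertyAt_of_additiveGluingDefect [NeZero d] {η : ℝ} (hη : 0 ≤ η)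
    (hAG : ∀ (n : ℕ) (w : Sym2 (Fin n) → unitInterval) (A : Finset (Fin n)) (o b : Fin n) (t : ℝ), 0 ≤ t →
      (∀ a ∈ A, 1 - t ≤ (prodBernoulli w).real (openConn a b)) →
      (prodBernoulli w).real (⋃ a ∈ A, openConn o a) - t - η ≤ (prodBernoulli w).real (openConn o b))
    (p : unitInterval) (hp1 : (p : ℝ) < 1)
    {δ : ℝ} (hδ : 0 < δ) (H : List (Geom d)) {m M ℓmax k R : ℕ} (hmM : m < M)
    (hhit : ∀ g ∈ H, ∀ ℓ : ℕ, ℓmax ≤ ℓ →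
      1 - δ ^ 2 < (bondPercolation (zdGraph d) p).real (linkIn (↑(g.Qset ℓ 0)) (box d m) (g.Fset ℓ 0)))
    (hface : ∀ (a : Fin d) (τ : Fin d → ℤˣ),
      1 - δ ^ 2 < (bondPercolation (zdGraph d) p).real (linkEvent (box d m) (orthantFace a τ M) M))
    (huniq : 1 - δ ^ 2 < (bondPercolation (zdGraph d) p).real (uniqZone m M))
    (hk : (1 - (p : ℝ) ^ seedBound d M) ^ k ≤ δ)
    (hR : 3 * M + ℓmax + 4 + ⌈(1 / (1 - (p : ℝ)) ^ (2 * d * LData.Ncont d M k)) / δ⌉₊ ≤ R) :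
    TargetPropertyAt d p (7 * δ + η) δ H R := by
  intro W Sfin D lo hi T o hfin hsub hDS ho hoD hBR htgt hTD hTne hreach
  have h := targetLemma_additive_defect p hp1 hδ H hmM hhit hface huniq hk hR W Sfin D lo hi T o hfin hsub hDS ho hoD hBR
    htgt hη (fun w' hw' A hA t ht haT =>
      additiveGluing_finSupp_set_defect hAG w' Sfin hw' A T o (↑D : Set (Site d)) hA (hTD.trans hDS) ho hTne ht haT)
  linarith

end Defect

end Summit.CriticalPhenomena.PercolationContinuityZ3.Theorems.Quant

end
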